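import Literature.NumberTheory.Automorphic.ChevalleyBlock
import Mathlib.LinearAlgebra.FreeModule.Finite.Basic
import HarnessLib

/-!
# The family of root matrices of a reduced based root datum (a `RootRep`)

Trunk T-AUTOMORPHIC (G25 AutomorphicL); the Lie-algebra half of Chevalley's existence theorem
(`Literature.NumberTheory.Automorphic.chevalley_existence`, Springer 10.1.1), final assembly after
`ChevalleyBlock.lean`. For a reduced root datum `P` over `ℤ` with base `b` and a Chevalley system
`S` over an algebraically closed field `k` of characteristic `0`:

* `rhoX P b = ∑ β` (the roots with `b.flip`-positive coroot; the tree's `twoRhoCoroot` of the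
  flipped datum), an element of the root lattice with **`⟨ρ_X, α_s^∨⟩ = 2`** for `s` simple, and
  the **dominant regular representative `domify x = x + n ρ_X`** of `x +` root lattice;
* the non-zero classes of a `ℤ`-basis of `X` modulo the root lattice (`hwClasses`, `clsAt`) and
  the **highest weights `Λ_0 = domify 0`, `Λ_{t+1} = domify (rep t)`** (`hwAt`): dominant,
  regular, with pairwise distinct classes (`hwAt_sub_hwAt_notMem`);
* the **family of blocks `L(Λ_j)`** (`famBlk`), the block-diagonal representation `gRep` of `L`
  on `V = ⊕_j L(Λ_j)` (a morphism for the commutator bracket, `gRepLie`, with `ρ(h_s)` the torus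
  matrix of `⟨·, α_s^∨⟩` and `ρ(e_α) = E_α`), whence `[E_α, E_β] ∈ 𝔤_V` (`sigmaE_mul_sub_mem`) and
  `E_α ∈ Lie ⟨𝔱_V, E_{±α_s}⟩` (`sigmaE_mem_lieSpan`, from `IsChevalleySystem.e_mem_lieSpan`);
* **the weights generate `X`** (`closure_sigmaWt_eq_top`: the simple roots are differences of
  weights of `L(Λ_0)`, and every basis vector of `X` is congruent to some `Λ_j`);
* packaged as **`theRootRep P b S : RootRep k P b (Fin (nCls P + 1)) (famIdx P b S)`**
  (`ChevalleyGroupData.lean`), the input of the group construction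
  (`ChevalleyGroupRootDatum.lean`).

Everything is proved; statements are [folklore] (Steinberg, *Lectures on Chevalley groups*, §§3,
5; Springer 10.2). Nothing here duplicates Mathlib or the tree.
-/

noncomputable section

open Set Function Finsupp UniversalEnvelopingAlgebra LieModule
open Literature.Algebra.Lie.PBW

attribute [local instance 100] LieRing.ofAssociativeRing

namespace Literature.NumberTheory.Automorphic

namespace ChevalleyVerma

variable {ι X Y : Type*} [AddCommGroup X] [AddCommGroup Y] [Fintype ι] [DecidableEq ι]
variable (P : RootPairing ι ℤ X Y) (b : P.Base)

/-! ### A dominant regular element of the root lattice -/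

/-- `ρ_X = ∑ β` over the roots `β` whose coroot is positive for the flipped base: an element of the
root lattice with `⟨ρ_X, α_s^∨⟩ = 2` for every simple `s` (the tree's `twoRhoCoroot` of the flipped
datum, `BasePosCoweight.lean`). [folklore] -/
def rhoX : X := b.flip.twoRhoCoroot

omit [DecidableEq ι] in
/-- **`⟨ρ_X, α_s^∨⟩ = 2` for simple `s`.** [folklore] -/
theorem toLinearMap_rhoX_coroot [P.IsReduced] {s : ι} (hs : s ∈ b.support) :
    P.toLinearMap (rhoX P b) (P.coroot s) = 2 := by
  have : Module.IsReflexive ℤ X := .of_isPerfPair P.toLinearMap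
  have : Module.IsReflexive ℤ Y := .of_isPerfPair P.flip.toLinearMap
  exact b.flip.root'_twoRhoCoroot_of_mem_support (j := s) hs

omit [DecidableEq ι] in
/-- `ρ_X` lies in the root lattice. [folklore] -/
theorem rhoX_mem_rootSpan : rhoX P b ∈ P.rootSpan ℤ := by
  unfold rhoX RootPairing.Base.twoRhoCoroot
  exact Submodule.sum_mem _ fun i _ => Submodule.subset_span (mem_range_self i)

/-! ### Dominant regular representatives of the cosets of the root lattice -/

/-- The shift making `x + n ρ_X` dominant regular. [folklore] -/
def nshift (x : X) : ℕ := ∑ s : b.support, (1 - P.toLinearMap x (P.coroot s)).toNat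

/-- **A dominant regular element of `x +` root lattice**: `x + n ρ_X`. [folklore] -/
def domify (x : X) : X := x + nshift P b x • rhoX P b

omit [DecidableEq ι] in
/-- `⟨domify x, α_s^∨⟩ ≥ 1` for simple `s`. [folklore] -/
theorem one_le_toLinearMap_domify [P.IsReduced] (x : X) {s : ι} (hs : s ∈ b.support) :
    1 ≤ P.toLinearMap (domify P b x) (P.coroot s) := by
  rw [domify, map_add, LinearMap.add_apply, map_nsmul, LinearMap.smul_apply,
    toLinearMap_rhoX_coroot P b hs, nsmul_eq_mul]
  have h1 : ((1 - P.toLinearMap x (P.coroot s)).toNat : ℤ) ≤ nshift P b x := by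
    have := Finset.single_le_sum (f := fun t : b.support => (1 - P.toLinearMap x (P.coroot t)).toNat)
      (fun t _ => Nat.zero_le _) (Finset.mem_univ (⟨s, hs⟩ : b.support))
    exact_mod_cast this
  have h2 : 1 - P.toLinearMap x (P.coroot s) ≤ ((1 - P.toLinearMap x (P.coroot s)).toNat : ℤ) :=
    Int.self_le_toNat _
  linarith

omit [DecidableEq ι] in
/-- `domify x` is dominant. [folklore] -/
theorem isDominant_domify [P.IsReduced] (x : X) : RootDatumWeights.IsDominant P b (domify P b x) :=
  fun _ hs => le_trans zero_le_one (one_le_toLinearMap_domify P b x hs)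

omit [DecidableEq ι] in
/-- `domify x ≡ x` modulo the root lattice. [folklore] -/
theorem domify_sub_mem (x : X) : domify P b x - x ∈ P.rootSpan ℤ := by
  rw [domify, add_sub_cancel_left]
  exact Submodule.smul_of_tower_mem _ _ (rhoX_mem_rootSpan P b)

/-! ### The classes of `X` modulo the root lattice -/

variable [Module.Finite ℤ X]

open scoped Classical in
/-- The non-zero classes of a `ℤ`-basis of `X` in `X ⧸` root lattice (a finite set generating the
quotient together with `0`). [folklore] -/
def hwClasses : Finset (X ⧸ P.rootSpan ℤ) :=
  haveI := RootDatumBaseChange.free_of_rootPairing P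
  (Finset.univ.image fun t : Module.Free.ChooseBasisIndex ℤ X =>
    Submodule.Quotient.mk (Module.Free.chooseBasis ℤ X t)).erase 0

/-- The number of non-zero classes. [folklore] -/
def nCls : ℕ := (hwClasses P).card

/-- An enumeration of the non-zero classes. [folklore] -/
def clsAt (t : Fin (nCls P)) : X ⧸ P.rootSpan ℤ := ((hwClasses P).equivFin.symm t : X ⧸ P.rootSpan ℤ)

omit [DecidableEq ι] [Fintype ι] in
/-- The enumerated classes are the non-zero classes. [folklore] -/
lemma clsAt_mem (t : Fin (nCls P)) : clsAt P t ∈ hwClasses P := ((hwClasses P).equivFin.symm t).2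

omit [DecidableEq ι] [Fintype ι] in
/-- The enumeration is injective. [folklore] -/
lemma clsAt_injective : Function.Injective (clsAt P) := fun _ _ htt' =>
  (hwClasses P).equivFin.symm.injective (Subtype.ext htt')

omit [DecidableEq ι] [Fintype ι] in
/-- The enumerated classes are non-zero. [folklore] -/
lemma clsAt_ne_zero (t : Fin (nCls P)) : clsAt P t ≠ 0 := by
  classical
  have := clsAt_mem P t
  unfold hwClasses at this
  exact Finset.ne_of_mem_erase this

omit [DecidableEq ι] [Fintype ι] in
/-- Every basis class is `0` or enumerated. [folklore] -/
lemma mk_chooseBasis_eq (t' : @Module.Free.ChooseBasisIndex ℤ X _ _ _ (RootDatumBaseChange.free_of_rootPairing P)) :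
    Submodule.Quotient.mk (p := P.rootSpan ℤ)
        (@Module.Free.chooseBasis ℤ X _ _ _ (RootDatumBaseChange.free_of_rootPairing P) t') = 0 ∨
      ∃ t, clsAt P t = Submodule.Quotient.mk
        (@Module.Free.chooseBasis ℤ X _ _ _ (RootDatumBaseChange.free_of_rootPairing P) t') := by
  classical
  by_cases h0 : Submodule.Quotient.mk (p := P.rootSpan ℤ)
      (@Module.Free.chooseBasis ℤ X _ _ _ (RootDatumBaseChange.free_of_rootPairing P) t') = 0
  · exact Or.inl h0
  · right
    have hmem : Submodule.Quotient.mk (p := P.rootSpan ℤ)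
        (@Module.Free.chooseBasis ℤ X _ _ _ (RootDatumBaseChange.free_of_rootPairing P) t') ∈ hwClasses P := by
      unfold hwClasses
      exact Finset.mem_erase.2 ⟨h0, Finset.mem_image_of_mem _ (Finset.mem_univ t')⟩
    exact ⟨(hwClasses P).equivFin ⟨_, hmem⟩, by simp [clsAt]⟩

/-- A representative of an enumerated class. [folklore] -/
def clsRep (t : Fin (nCls P)) : X := (Submodule.Quotient.mk_surjective (P.rootSpan ℤ) (clsAt P t)).choose

omit [DecidableEq ι] [Fintype ι] in
/-- `clsRep t` represents `clsAt t`. [folklore] -/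
lemma mk_clsRep (t : Fin (nCls P)) : Submodule.Quotient.mk (clsRep P t) = clsAt P t :=
  (Submodule.Quotient.mk_surjective (P.rootSpan ℤ) (clsAt P t)).choose_spec

/-! ### The highest weights of the family -/

/-- **The highest weights**: `Λ_0 = domify 0` (class `0`) and `Λ_{t+1} = domify (rep t)` for the
non-zero classes `t`. [folklore] -/
def hwAt : Fin (nCls P + 1) → X := Fin.cases (domify P b 0) fun t => domify P b (clsRep P t)

omit [DecidableEq ι] in
/-- `hwAt 0`. [folklore] -/
@[simp] lemma hwAt_zero : hwAt P b 0 = domify P b 0 := rfl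

omit [DecidableEq ι] in
/-- `hwAt (t+1)`. [folklore] -/
@[simp] lemma hwAt_succ (t : Fin (nCls P)) : hwAt P b t.succ = domify P b (clsRep P t) := rfl

omit [DecidableEq ι] in
/-- The highest weights are dominant. [folklore] -/
theorem isDominant_hwAt [P.IsReduced] (j : Fin (nCls P + 1)) : RootDatumWeights.IsDominant P b (hwAt P b j) := by
  refine Fin.cases ?_ (fun t => ?_) j
  · exact isDominant_domify P b 0
  · exact isDominant_domify P b _

omit [DecidableEq ι] in
/-- The highest weights are regular: `⟨Λ_j, α_s^∨⟩ ≥ 1`. [folklore] -/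
theorem one_le_hwAt [P.IsReduced] (j : Fin (nCls P + 1)) {s : ι} (hs : s ∈ b.support) :
    1 ≤ P.toLinearMap (hwAt P b j) (P.coroot s) := by
  refine Fin.cases ?_ (fun t => ?_) j
  · exact one_le_toLinearMap_domify P b 0 hs
  · exact one_le_toLinearMap_domify P b _ hs

omit [DecidableEq ι] in
/-- The class of `Λ_0` is `0`. [folklore] -/
lemma mk_hwAt_zero : Submodule.Quotient.mk (p := P.rootSpan ℤ) (hwAt P b 0) = 0 := by
  rw [hwAt_zero, Submodule.Quotient.mk_eq_zero]
  simpa using domify_sub_mem P b 0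

omit [DecidableEq ι] in
/-- The class of `Λ_{t+1}` is `clsAt t`. [folklore] -/
lemma mk_hwAt_succ (t : Fin (nCls P)) : Submodule.Quotient.mk (p := P.rootSpan ℤ) (hwAt P b t.succ) = clsAt P t := by
  rw [hwAt_succ, ← mk_clsRep P t, eq_comm, ← sub_eq_zero, ← Submodule.Quotient.mk_sub,
    Submodule.Quotient.mk_eq_zero, ← Submodule.neg_mem_iff, neg_sub]
  exact domify_sub_mem P b _

omit [DecidableEq ι] in
/-- **Distinct highest weights have distinct classes.** [folklore] -/
theorem hwAt_sub_hwAt_notMem {j j' : Fin (nCls P + 1)} (hjj' : j ≠ j') :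
    hwAt P b j - hwAt P b j' ∉ P.rootSpan ℤ := by
  intro hmem
  apply hjj'
  have hmk : Submodule.Quotient.mk (p := P.rootSpan ℤ) (hwAt P b j) = Submodule.Quotient.mk (hwAt P b j') := by
    rw [← sub_eq_zero, ← Submodule.Quotient.mk_sub, Submodule.Quotient.mk_eq_zero]
    exact hmem
  revert hmk
  refine Fin.cases ?_ (fun t => ?_) j <;> refine Fin.cases ?_ (fun t' => ?_) j'
  · exact fun _ => rfl
  · intro hmk
    rw [mk_hwAt_zero, mk_hwAt_succ] at hmk
    exact absurd hmk.symm (clsAt_ne_zero P t')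
  · intro hmk
    rw [mk_hwAt_zero, mk_hwAt_succ] at hmk
    exact absurd hmk (clsAt_ne_zero P t)
  · intro hmk
    rw [mk_hwAt_succ, mk_hwAt_succ] at hmk
    rw [clsAt_injective P hmk]

/-! ### The family of blocks -/

section Family

variable {k : Type*} [Field k] [CharZero k] [IsAlgClosed k] [P.IsReduced]
variable {L : Type*} [LieRing L] [LieAlgebra k L] {h : b.support → L} {e : ι → L}
  (S : IsChevalleySystem P b k h e)

/-- The index types of the blocks `L(Λ_j)`. [folklore] -/
def famIdx (j : Fin (nCls P + 1)) : Type := BlkIdx S (hwAt P b j) (isDominant_hwAt P b j)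

/-- Finiteness of the index types. [folklore] -/
instance (j : Fin (nCls P + 1)) : Fintype (famIdx P b S j) :=
  inferInstanceAs (Fintype (BlkIdx S (hwAt P b j) (isDominant_hwAt P b j)))

/-- Decidable equality of the index types. [folklore] -/
instance (j : Fin (nCls P + 1)) : DecidableEq (famIdx P b S j) :=
  inferInstanceAs (DecidableEq (BlkIdx S (hwAt P b j) (isDominant_hwAt P b j)))

/-- **The blocks `L(Λ_j)` of the family.** [folklore] -/
def famBlk (j : Fin (nCls P + 1)) : RootRepBlock k P (famIdx P b S j) :=
  blk S (hwAt P b j) (isDominant_hwAt P b j)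

/-- The representation of `L` on the `j`-th block. [folklore] -/
def famRep (j : Fin (nCls P + 1)) (x : L) : Matrix (famIdx P b S j) (famIdx P b S j) k :=
  blkRep S (hwAt P b j) (isDominant_hwAt P b j) x

/-- Weights of the blocks. [folklore] -/
lemma famBlk_wt (j : Fin (nCls P + 1)) :
    (famBlk P b S j).wt = blkWt S (hwAt P b j) (isDominant_hwAt P b j) := rfl

/-- Root matrices of the blocks. [folklore] -/
lemma famBlk_E (j : Fin (nCls P + 1)) (i : ι) : (famBlk P b S j).E i = famRep P b S j (e i) := rfl

/-- The block representations are additive. [folklore] -/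
lemma famRep_add (j : Fin (nCls P + 1)) (x y : L) :
    famRep P b S j (x + y) = famRep P b S j x + famRep P b S j y := map_add _ x y

/-- The block representations are homogeneous. [folklore] -/
lemma famRep_smul (j : Fin (nCls P + 1)) (c : k) (x : L) :
    famRep P b S j (c • x) = c • famRep P b S j x := map_smul _ c x

/-- The block representations are morphisms for the commutator bracket. [folklore] -/
lemma famRep_lie (j : Fin (nCls P + 1)) (x y : L) :
    famRep P b S j ⁅x, y⁆ = famRep P b S j x * famRep P b S j y - famRep P b S j y * famRep P b S j x :=
  blkRep_lie S _ _ x y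

/-- `h_s` on a block. [folklore] -/
lemma famRep_h (j : Fin (nCls P + 1)) (s : b.support) :
    famRep P b S j (h s) = torusDiag (famBlk P b S j).wt (corootForm (k := k) P s) :=
  blkRep_h S _ _ s

/-- **The representation of `L` on `V = ⊕_j L(Λ_j)`** (block diagonal). [folklore] -/
def gRep (x : L) : Matrix (Σ j, famIdx P b S j) (Σ j, famIdx P b S j) k :=
  Matrix.blockDiagonal' fun j => famRep P b S j x

/-- `ρ(e_α) = E_α`, the global root matrix. [folklore] -/
lemma gRep_e (i : ι) : gRep P b S (e i) = sigmaE (famBlk P b S) i := rfl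

/-- **`ρ(h_s)` is the torus matrix `D_{⟨·, α_s^∨⟩}`.** [folklore] -/
lemma gRep_h (s : b.support) : gRep P b S (h s) = torusDiag (sigmaWt (famBlk P b S)) (corootForm (k := k) P s) := by
  change Matrix.blockDiagonal' (fun j => famRep P b S j (h s)) = _
  simp_rw [famRep_h]
  exact Matrix.blockDiagonal'_diagonal fun j a => corootForm (k := k) P s ((famBlk P b S j).wt a)

/-- `ρ` is additive. [folklore] -/
lemma gRep_add (x y : L) : gRep P b S (x + y) = gRep P b S x + gRep P b S y := by
  change Matrix.blockDiagonal' (fun j => famRep P b S j (x + y)) =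
    Matrix.blockDiagonal' (fun j => famRep P b S j x) + Matrix.blockDiagonal' (fun j => famRep P b S j y)
  rw [← Matrix.blockDiagonal'_add]
  congr 1
  funext j
  exact famRep_add P b S j x y

/-- `ρ` is homogeneous. [folklore] -/
lemma gRep_smul (c : k) (x : L) : gRep P b S (c • x) = c • gRep P b S x := by
  change Matrix.blockDiagonal' (fun j => famRep P b S j (c • x)) = c • Matrix.blockDiagonal' (fun j => famRep P b S j x)
  rw [← Matrix.blockDiagonal'_smul]
  congr 1
  funext j
  exact famRep_smul P b S j c x

/-- **`ρ` is a morphism for the commutator bracket.** [folklore] -/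
lemma gRep_lie (x y : L) : gRep P b S ⁅x, y⁆ = gRep P b S x * gRep P b S y - gRep P b S y * gRep P b S x := by
  change Matrix.blockDiagonal' (fun j => famRep P b S j ⁅x, y⁆) =
    Matrix.blockDiagonal' (fun j => famRep P b S j x) * Matrix.blockDiagonal' (fun j => famRep P b S j y) -
      Matrix.blockDiagonal' (fun j => famRep P b S j y) * Matrix.blockDiagonal' (fun j => famRep P b S j x)
  rw [← Matrix.blockDiagonal'_mul, ← Matrix.blockDiagonal'_mul, ← Matrix.blockDiagonal'_sub]
  congr 1
  funext j
  exact famRep_lie P b S j x y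

/-- `ρ` as a `k`-linear map. [folklore] -/
def gRepLin : L →ₗ[k] Matrix (Σ j, famIdx P b S j) (Σ j, famIdx P b S j) k where
  toFun := gRep P b S
  map_add' := gRep_add P b S
  map_smul' := gRep_smul P b S

/-- `ρ` as a morphism of Lie algebras. [folklore] -/
def gRepLie : L →ₗ⁅k⁆ Matrix (Σ j, famIdx P b S j) (Σ j, famIdx P b S j) k :=
  { gRepLin P b S with
    map_lie' := fun {x y} => by
      change gRep P b S ⁅x, y⁆ = ⁅gRep P b S x, gRep P b S y⁆
      rw [gRep_lie, LieRing.of_associative_ring_bracket] }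

/-- Values of `gRepLie`. [folklore] -/
@[simp] lemma gRepLie_apply (x : L) : gRepLie P b S x = gRep P b S x := rfl

/-- **`ρ(L) ⊆ 𝔤_V = 𝔱_V + ∑ k E_α`.** [folklore] -/
theorem gRep_mem_rootRepLie (x : L) : gRep P b S x ∈ rootRepLie (famBlk P b S) := by
  rw [← S.basis.sum_repr x, ← gRepLie_apply, map_sum]
  refine Submodule.sum_mem _ fun j _ => ?_
  rw [map_smul]
  refine Submodule.smul_mem _ _ ?_
  rw [gRepLie_apply, IsChevalleySystem.coe_basis]
  rcases j with s | i
  · rw [Sum.elim_inl, gRep_h]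
    exact Submodule.mem_sup_left (torusDiag_mem_torusLie _)
  · rw [Sum.elim_inr, gRep_e]
    exact Submodule.mem_sup_right (Submodule.subset_span (mem_range_self i))

/-- **`[E_α, E_β] ∈ 𝔤_V`.** [folklore] -/
theorem sigmaE_mul_sub_mem (i i' : ι) :
    sigmaE (famBlk P b S) i * sigmaE (famBlk P b S) i' - sigmaE (famBlk P b S) i' * sigmaE (famBlk P b S) i ∈
      rootRepLie (famBlk P b S) := by
  rw [← gRep_e, ← gRep_e, ← gRep_lie]
  exact gRep_mem_rootRepLie P b S _

/-- **Every `E_α` lies in the Lie algebra generated by `𝔱_V` and the simple `E_{±α_s}`.** [folklore] -/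
theorem sigmaE_mem_lieSpan (i : ι) :
    sigmaE (famBlk P b S) i ∈ LieSubalgebra.lieSpan k (Matrix (Σ j, famIdx P b S j) (Σ j, famIdx P b S j) k)
      ((torusLie (k := k) (sigmaWt (famBlk P b S)) : Set (Matrix (Σ j, famIdx P b S j) (Σ j, famIdx P b S j) k)) ∪
        ⋃ i' ∈ b.support, {sigmaE (famBlk P b S) i', sigmaE (famBlk P b S) (P.reflectionPerm i' i')}) := by
  set T := ((torusLie (k := k) (sigmaWt (famBlk P b S)) : Set (Matrix (Σ j, famIdx P b S j) (Σ j, famIdx P b S j) k)) ∪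
    ⋃ i' ∈ b.support, {sigmaE (famBlk P b S) i', sigmaE (famBlk P b S) (P.reflectionPerm i' i')}) with hT
  have hK : (range h ∪ ⋃ s : b.support, {e s, e (P.reflectionPerm s s)}) ⊆
      ((LieSubalgebra.lieSpan k _ T).comap (gRepLie P b S) : Set L) := by
    rintro x (⟨s, rfl⟩ | hx)
    · rw [SetLike.mem_coe, LieSubalgebra.mem_comap, gRepLie_apply, gRep_h]
      exact LieSubalgebra.subset_lieSpan (Or.inl (torusDiag_mem_torusLie _))
    · simp only [Set.mem_iUnion, Set.mem_insert_iff, Set.mem_singleton_iff] at hx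
      obtain ⟨s, rfl | rfl⟩ := hx
      · rw [SetLike.mem_coe, LieSubalgebra.mem_comap, gRepLie_apply, gRep_e]
        refine LieSubalgebra.subset_lieSpan (Or.inr ?_)
        simp only [Set.mem_iUnion, Set.mem_insert_iff, Set.mem_singleton_iff]
        exact ⟨s, s.2, Or.inl rfl⟩
      · rw [SetLike.mem_coe, LieSubalgebra.mem_comap, gRepLie_apply, gRep_e]
        refine LieSubalgebra.subset_lieSpan (Or.inr ?_)
        simp only [Set.mem_iUnion, Set.mem_insert_iff, Set.mem_singleton_iff]
        exact ⟨s, s.2, Or.inr rfl⟩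
  have hle := LieSubalgebra.lieSpan_le.2 hK
  have hmem := hle (S.e_mem_lieSpan i)
  rw [LieSubalgebra.mem_comap, gRepLie_apply, gRep_e] at hmem
  exact hmem

/-! ### The weights generate `X` -/

/-- **The weights of the family generate `X`**: the simple roots are differences of weights of
`L(Λ_0)` (`Λ_0` regular), so the root lattice is contained in the subgroup generated; every basis
vector of `X` is congruent to some `Λ_j` modulo the root lattice. [folklore] -/
theorem closure_sigmaWt_eq_top : AddSubgroup.closure (Set.range (sigmaWt (famBlk P b S))) = ⊤ := by
  set H := AddSubgroup.closure (Set.range (sigmaWt (famBlk P b S))) with hH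
  have hwt : ∀ (j) (a : famIdx P b S j), blkWt S (hwAt P b j) (isDominant_hwAt P b j) a ∈ H := fun j a =>
    AddSubgroup.subset_closure ⟨⟨j, a⟩, rfl⟩
  -- the highest weights are in `H`
  have hhw : ∀ j, hwAt P b j ∈ H := fun j => by
    obtain ⟨a, ha⟩ := exists_blkWt_eq_self S (hwAt P b j) (isDominant_hwAt P b j)
    rw [← ha]; exact hwt j a
  -- the simple roots, hence the root lattice, are in `H`
  have hroot : ∀ s ∈ b.support, P.root s ∈ H := fun s hs => by
    obtain ⟨a, ha⟩ := exists_blkWt_eq_sub S (hwAt P b 0) (isDominant_hwAt P b 0) hs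
      (lt_of_lt_of_le zero_lt_one (one_le_hwAt P b 0 hs))
    have h1 : P.root s = hwAt P b 0 - (hwAt P b 0 - P.root s) := by abel
    rw [h1, ← ha]
    exact H.sub_mem (hhw 0) (hwt 0 a)
  have hQ : ∀ x ∈ P.rootSpan ℤ, x ∈ H := by
    intro x hx
    rw [← b.span_root_support] at hx
    have hle : (Submodule.span ℤ (P.root '' (b.support : Set ι))).toAddSubgroup ≤ H := by
      rw [Submodule.span_int_eq_addSubgroupClosure, AddSubgroup.closure_le]
      rintro _ ⟨s, hs, rfl⟩
      exact hroot s hs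
    exact hle hx
  -- every basis vector of `X` is in `H`
  haveI := RootDatumBaseChange.free_of_rootPairing P
  set bX := @Module.Free.chooseBasis ℤ X _ _ _ (RootDatumBaseChange.free_of_rootPairing P) with hbX
  have hbasis : ∀ t', bX t' ∈ H := by
    intro t'
    rcases mk_chooseBasis_eq P t' with h0 | ⟨t, ht⟩
    · exact hQ _ ((Submodule.Quotient.mk_eq_zero _).1 h0)
    · have hdiff : bX t' - hwAt P b t.succ ∈ P.rootSpan ℤ := by
        rw [← Submodule.Quotient.mk_eq_zero, Submodule.Quotient.mk_sub, sub_eq_zero, mk_hwAt_succ, ← ht]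
      have h1 : bX t' = (bX t' - hwAt P b t.succ) + hwAt P b t.succ := by abel
      rw [h1]
      exact H.add_mem (hQ _ hdiff) (hhw _)
  -- conclude
  rw [eq_top_iff]
  intro x _
  have hx : x ∈ Submodule.span ℤ (Set.range bX) := by rw [bX.span_eq]; exact Submodule.mem_top
  have hle : (Submodule.span ℤ (Set.range bX)).toAddSubgroup ≤ H := by
    rw [Submodule.span_int_eq_addSubgroupClosure, AddSubgroup.closure_le]
    rintro _ ⟨t', rfl⟩
    exact hbasis t'
  exact hle hx

/-- **The weight map of the family is surjective.** [folklore] -/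
theorem wtHom_sigmaWt_surjective : Function.Surjective (wtHom (sigmaWt (famBlk P b S))) := by
  rw [← AddMonoidHom.range_eq_top, eq_top_iff, ← closure_sigmaWt_eq_top P b S, AddSubgroup.closure_le]
  rintro _ ⟨x, rfl⟩
  classical
  exact ⟨Pi.single x 1, wtHom_single x⟩

/-! ### The `RootRep` -/

/-- **The infinitesimal data of the split reductive group with based root datum `(P, b)`**: the
family of blocks `L(Λ_j)` (`RootRep`, `ChevalleyGroupData.lean`) — the Lie-algebra half of
Chevalley's existence theorem for every reduced based root datum over an algebraically closed
field of characteristic `0`. [folklore] -/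
def theRootRep : RootRep k P b (Fin (nCls P + 1)) (famIdx P b S) where
  blk := famBlk P b S
  wt_surjective := wtHom_sigmaWt_surjective P b S
  hw := hwAt P b
  exists_wt_eq_hw := fun j => exists_blkWt_eq_self S (hwAt P b j) (isDominant_hwAt P b j)
  wt_ne_hw := fun j j' hjj' a ha => by
    apply hwAt_sub_hwAt_notMem P b (Ne.symm hjj')
    have h1 := blkWt_sub_mem_rootSpan S (hwAt P b j') (isDominant_hwAt P b j') a
    change blkWt S (hwAt P b j') (isDominant_hwAt P b j') a = hwAt P b j at ha
    rw [ha] at h1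
    exact h1
  E_mul_E_sub_mem := sigmaE_mul_sub_mem P b S
  E_mem_lieSpan := sigmaE_mem_lieSpan P b S

end Family

end ChevalleyVerma

end Literature.NumberTheory.Automorphic
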